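import Mathlib
import Literature.Computability.AlgebraicComplexity.AsymptoticRankZariskiClosedProofs
import Literature.Computability.AlgebraicComplexity.AsymptoticSumInequalityAsymptoticRank
import Literature.Barriers.MatrixMultiplication.UniversalMethodBarrierAsymptoticRank
import Summits.MatrixMultiplication.MatrixMultiplication.Theorems.StrassenDefectHalfSizeCoverAssembly
import Summits.MatrixMultiplication.MatrixMultiplication.Theorems.NilpotentLieHostsHostingBound

/-!
# Closure pricing — stub `stub_closurePricing` of line `SketchIdeator1`
(crux `GLnSeparatingDesigns.SeparationDegreeCost`, stmt-MatrixMultiplication-18361)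

Blasiak–Cohn–Grochow–Pratt–Umans 2024, Cor. 2.8, border clause, with BCGPU Thm. 2.6 replaced by the
Christandl–Hoeberechts–Nieuwboer–Vrana–Zuiddam theorem (tree:
`chnvz_zariskiClosed_asymptoticRank_le_holds`): if for every `η > 0` some restriction `T_η` of
`⊕ᵢ ⟨dᵢ,dᵢ,dᵢ⟩ = matMulDirectSum ℂ d d d` is entrywise `η`-close to `⟨N₁,N₂,N₃⟩`, then
`(N₁N₂N₃)^{ω/3} ≤ Σᵢ dᵢ^ω`.

Proof. Put `R := R̃(⊕ᵢ ⟨dᵢ,dᵢ,dᵢ⟩)`.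
* `R̃(T_η) ≤ R` for every `η` (a restriction is a degeneration, `TensorRestrictsTo.polyDegeneratesTo`,
  and `R̃` is degeneration-monotone, `asymptoticRank_le_of_polyDegeneratesTo`);
* the sublevel set `{t | R̃(t) ≤ R}` is Euclidean-closed (CHNVZ 2025 Thm 1.2,
  `chnvz_zariskiClosed_asymptoticRank_le_holds.isClosed_complex`) and `⟨N₁,N₂,N₃⟩` lies in its closure
  (sup metric on the finite function space, `dist_pi_le_iff`), so `R̃(⟨N₁,N₂,N₃⟩) ≤ R`
  (`asymptoticRank_le_of_forall_near`);
* `R ≤ Σᵢ dᵢ^ω` (`asymptoticRank_matMulDirectSum_le`, Theorems/StrassenDefectHalfSizeCoverAssembly);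
* `(N₁N₂N₃)^{ω/3} ≤ R̃(⟨N₁,N₂,N₃⟩)`: the asymptotic sum inequality with one summand
  (`sum_rpow_omega_le_asymptoticRank`) and the relabelling `⟨N₁,N₂,N₃⟩ ≥ ⊕_{i<1} ⟨N₁,N₂,N₃⟩`
  (`tensorRestrictsTo_matMulTensor_matMulDirectSum_one_rect`, Theorems/NilpotentLieHostsHostingBound),
  giving `rpow_omega_div_three_le_asymptoticRank_matMulTensor`.
-/

-- `Summit.MatrixMultiplication.MatrixMultiplication.…` is the tree's mandated summit-side namespace (Sub = Summit), flagged by `dupNamespace`.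
set_option linter.dupNamespace false

noncomputable section

open scoped BigOperators
open Literature.Computability.AlgebraicComplexity
open Literature.Barriers.MatrixMultiplication (asymptoticRank_le_of_polyDegeneratesTo)

namespace Summit.MatrixMultiplication.MatrixMultiplication.Theorems

/-- **`(N₁N₂N₃)^{ω/3} ≤ R̃(⟨N₁,N₂,N₃⟩)`** over any field: the asymptotic sum inequality for the
asymptotic rank with a single summand (Bürgisser–Clausen–Shokrollahi Ex. 15.24(7)), transported
along the relabelling `⟨N₁,N₂,N₃⟩ ≥ ⊕_{i<1} ⟨N₁,N₂,N₃⟩`. [folklore] -/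
theorem rpow_omega_div_three_le_asymptoticRank_matMulTensor (K : Type) [Field K] (N₁ N₂ N₃ : ℕ) :
    ((N₁ * N₂ * N₃ : ℕ) : ℝ) ^ (omega K / 3) ≤ asymptoticRank (matMulTensor K N₁ N₂ N₃) := by
  classical
  have h := sum_rpow_omega_le_asymptoticRank K (fun _ : Fin 1 => N₁) (fun _ => N₂) (fun _ => N₃)
  simp only [Finset.univ_unique, Finset.sum_singleton] at h
  exact h.trans (asymptoticRank_le_of_polyDegeneratesTo
    (tensorRestrictsTo_matMulTensor_matMulDirectSum_one_rect K N₁ N₂ N₃).polyDegeneratesTo)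

/-- **Lower semicontinuity of `R̃` over `ℂ`** (CHNVZ 2025, remark after Thm 1.2), in the entrywise
form: if `t` is, for every `η > 0`, entrywise `η`-close to a tensor of asymptotic rank `≤ R`, then
`R̃(t) ≤ R` — the sublevel set `{R̃ ≤ R}` is Euclidean-closed
(`chnvz_zariskiClosed_asymptoticRank_le_holds.isClosed_complex`) and `t` lies in its closure for the
sup metric. [folklore] -/
theorem asymptoticRank_le_of_forall_near {ι κ μ : Type} [Fintype ι] [Fintype κ] [Fintype μ]
    (t : ι → κ → μ → ℂ) (R : ℝ)
    (h : ∀ η : ℝ, 0 < η → ∃ T : ι → κ → μ → ℂ,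
      asymptoticRank T ≤ R ∧ ∀ a b c, ‖T a b c - t a b c‖ ≤ η) :
    asymptoticRank t ≤ R := by
  have hC : IsClosed {s : ι → κ → μ → ℂ | asymptoticRank s ≤ R} :=
    chnvz_zariskiClosed_asymptoticRank_le_holds.isClosed_complex R
  have hmem : t ∈ closure {s : ι → κ → μ → ℂ | asymptoticRank s ≤ R} := by
    rw [Metric.mem_closure_iff]
    intro ε hε
    obtain ⟨T, hT, hTt⟩ := h (ε / 2) (half_pos hε)
    refine ⟨T, hT, ?_⟩
    rw [dist_comm]
    calc dist T t ≤ ε / 2 := by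
          refine (dist_pi_le_iff (half_pos hε).le).2 fun a => ?_
          refine (dist_pi_le_iff (half_pos hε).le).2 fun b => ?_
          refine (dist_pi_le_iff (half_pos hε).le).2 fun c => ?_
          rw [dist_eq_norm]
          exact hTt a b c
      _ < ε := half_lt_self hε
  rw [hC.closure_eq] at hmem
  exact hmem

/-- **Stub S6 (closure pricing).** If for every `η > 0` some restriction `T` of `⊕ᵢ ⟨dᵢ,dᵢ,dᵢ⟩`
(`matMulDirectSum ℂ d d d`) is entrywise `η`-close to `⟨N₁,N₂,N₃⟩`, then
`(N₁N₂N₃)^{ω/3} ≤ Σᵢ dᵢ^ω`: `(N₁N₂N₃)^{ω/3} ≤ R̃(⟨N₁,N₂,N₃⟩) ≤ R̃(⊕⟨dᵢ⟩) ≤ Σ dᵢ^ω`, the middle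
step by Euclidean closedness of the sublevel sets of `R̃` (CHNVZ 2025) and degeneration
monotonicity (Blasiak–Cohn–Grochow–Pratt–Umans 2024, proof of Cor. 2.8 with Thm. 2.6). -/
theorem stub_closurePricing {r : ℕ} (d : Fin r → ℕ) [∀ i, NeZero (d i)] (N₁ N₂ N₃ : ℕ)
    (h : ∀ η : ℝ, 0 < η → ∃ T : Fin N₁ × Fin N₃ → Fin N₁ × Fin N₂ → Fin N₂ × Fin N₃ → ℂ,
      TensorRestrictsTo (matMulDirectSum ℂ d d d) T ∧
        ∀ a b c, ‖T a b c - matMulTensor ℂ N₁ N₂ N₃ a b c‖ ≤ η) :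
    ((N₁ * N₂ * N₃ : ℕ) : ℝ) ^ (omega ℂ / 3) ≤ ∑ i, ((d i : ℕ) : ℝ) ^ omega ℂ := by
  have hmid : asymptoticRank (matMulTensor ℂ N₁ N₂ N₃) ≤
      asymptoticRank (matMulDirectSum ℂ d d d) :=
    asymptoticRank_le_of_forall_near _ _ fun η hη => by
      obtain ⟨T, hT, hTη⟩ := h η hη
      exact ⟨T, asymptoticRank_le_of_polyDegeneratesTo hT.polyDegeneratesTo, hTη⟩
  exact (rpow_omega_div_three_le_asymptoticRank_matMulTensor ℂ N₁ N₂ N₃).trans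
    (hmid.trans (asymptoticRank_matMulDirectSum_le ℂ d))

end Summit.MatrixMultiplication.MatrixMultiplication.Theorems

end
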